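import Summits.KontsevichZagierPeriods.KontsevichZagierPeriods.Theses.HurwitzMicroSectors
import Summits.KontsevichZagierPeriods.KontsevichZagierPeriods.Theorems.HurwitzMicroSectorsNormalFormPrinciplePiBoxTransfer
import Summits.KontsevichZagierPeriods.KontsevichZagierPeriods.Theorems.HurwitzMicroSectorsNormalFormPrincipleVariants2340

/-! TTRL-lite variant V2223 of stmt-KontsevichZagierPeriods-3869

Variant V2223 = `stub_boxRigidity` (BoxRigidity: two box-rational representations — domain the open
unit box `(0,1)^m`, integrand `p/q`, `p, q ∈ ℚ[x]`, `q ≠ 0` on the box — with equal values are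
KZ-equivalent) under the JOINT small-case move `bound_nat:m≤2; bound_nat:m'≤5` (hypotheses in the
order `m' ≤ 5 → m ≤ 2`). Verdict of the attempt seat: **open** — this file is the exact-strength
certificate, not a proof of the variant:

* `stub_boxRigidity_var2223_iff_boxVanishingLe`: V2223 ⟺ BoxVanishing(dim ≤ 5) — every box-rational
  representation on `(0,1)^m`, `m ≤ 5`, of value `0` is a relation (instance `j = 2, k = 5` of the
  tree's `boxRigidityLe_iff_boxVanishingLe`, file `…Variants2340`: compare with the zero representation on the `0`-box one
  way; pad both representations to the common box and subtract the integrands the other way);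
* `stub_boxRigidity_var2223_iff_le_five`: the bound `m ≤ 2` is idle next to `m' ≤ 5` —
  V2223 ⟺ BoxRigidity(m, m' ≤ 5);
* `stub_boxRigidity_var2223_iff_boxVanishing_two_le_five`: since BoxVanishing(dim ≤ 1) is a THEOREM
  of the tree (`boxVanishingLe_one`, from `Dlog.boxRigidity_of_le_one`, Baker), the variant is exactly
  BoxVanishing in the dimensions `2 ≤ m ≤ 5`, i.e. Conjecture 1 for all box-rational periods of
  dimensions `2, 3, 4, 5`; already its dimension-`2` layer (`boxVanishing_two_of_stub_boxRigidity_var2223`)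
  decides every `ℚ`-linear relation among `1, π², log 2, π log 2, log² 2, G` (Catalan), `ζ(3)`, … in
  favour of the four moves — for every `c : ℚ` it contains `G = c → [(0,1)², 1/(1+x²y²) − c] ∈ relations`,
  so a proof is an irrationality proof of `G` or an explicit chain of moves, neither of which exists;
* `stub_boxRigidity_var2223_of_statement`: `KontsevichZagierPeriods → V2223`, so a refutation of the
  variant would refute the Summit, and no invariant of the moves beyond `eval` is known
  (`relations_le_ker_eval_holds` is the only proved constraint).

Source: M. Kontsevich, D. Zagier, *Periods* (2001), §1.2 Conjecture 1 and rules 1)–3); A. Baker,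
*Transcendental Number Theory* (1975), Thm. 2.1 (the proved rung). Pure proof file, no definitions. -/

-- `Summit.<Summit>.<Problem>` is the tree's mandated summit-side namespace (CONVENTIONS §2); for this
-- single-conjunct summit the two coincide, so the duplicate is deliberate.
set_option linter.dupNamespace false

noncomputable section

namespace Summit.KontsevichZagierPeriods.KontsevichZagierPeriods.Theorems

open MeasureTheory Set
open Literature.NumberTheory.Transcendental Literature.NumberTheory.Transcendental.KZ
open Summit.KontsevichZagierPeriods.KontsevichZagierPeriods.Theses.HurwitzMicroSectors
open Summit.KontsevichZagierPeriods.HurwitzMicroSectors.NormalFormPrinciple.PiBox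

/-! ## The variant V2223: Conjecture 1 for box-rational periods of dimension `≤ 5` -/

/-- **V2223 with its hypotheses in the standard order**: `m' ≤ 5 → m ≤ 2 → …` is
`BoxRigidity(m ≤ 2, m' ≤ 5)`. [cite: KontsevichZagier2001, §1.2 Conjecture 1] -/
theorem stub_boxRigidity_var2223_iff_swap :
    (∀ (m m' : ℕ) (N : IntegralRep m) (N' : IntegralRep m'), m' ≤ 5 → m ≤ 2 → N.domain = {x | ∀ i, x i ∈ Set.Ioo (0:ℝ) 1} → N.IsRational → N'.domain = {x | ∀ i, x i ∈ Set.Ioo (0:ℝ) 1} → N'.IsRational → N.value = N'.value → Equivalent N N') ↔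
    (∀ (m m' : ℕ) (N : IntegralRep m) (N' : IntegralRep m'), m ≤ 2 → m' ≤ 5 →
      N.domain = {x | ∀ i, x i ∈ Set.Ioo (0:ℝ) 1} → N.IsRational →
      N'.domain = {x | ∀ i, x i ∈ Set.Ioo (0:ℝ) 1} → N'.IsRational →
      N.value = N'.value → Equivalent N N') :=
  ⟨fun h m m' N N' hm hm' => h m m' N N' hm' hm, fun h m m' N N' hm' hm => h m m' N N' hm hm'⟩

/-- **V2223 ⟺ BoxVanishing(dim ≤ 5)**: the variant is exactly "every representation on `(0,1)^m`,
`m ≤ 5`, with integrand of KZ's rational shape over `ℚ` and value `0` is a KZ relation" — Conjecture 1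
for all box-rational periods of dimension `≤ 5`, open (instance `j = 2`, `k = 5` of the
joint-bound equivalence). [cite: KontsevichZagier2001, §1.2 Conjecture 1] -/
theorem stub_boxRigidity_var2223_iff_boxVanishingLe :
    (∀ (m m' : ℕ) (N : IntegralRep m) (N' : IntegralRep m'), m' ≤ 5 → m ≤ 2 → N.domain = {x | ∀ i, x i ∈ Set.Ioo (0:ℝ) 1} → N.IsRational → N'.domain = {x | ∀ i, x i ∈ Set.Ioo (0:ℝ) 1} → N'.IsRational → N.value = N'.value → Equivalent N N') ↔
    (∀ (m : ℕ) (N : IntegralRep m), m ≤ 5 → N.domain = {x | ∀ i, x i ∈ Set.Ioo (0:ℝ) 1} →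
      N.IsRational → N.value = 0 → of N ∈ relations) := by
  rw [stub_boxRigidity_var2223_iff_swap]
  exact ⟨fun h m N hm => boxVanishingLe_of_boxRigidityLe 2 5 h m N (hm.trans (le_max_right 2 5)),
    fun h => boxRigidityLe_of_boxVanishingLe 2 5 5 (max_le (by norm_num) le_rfl) h⟩

/-- **V2223 ⟺ BoxRigidity(m, m' ≤ 5)**: the bound `m ≤ 2` is idle next to `m' ≤ 5` (a joint bound
is worth BoxVanishing up to the LARGER bound), and the variant is
symmetric in the two slots. [cite: KontsevichZagier2001, §1.2 Conjecture 1] -/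
theorem stub_boxRigidity_var2223_iff_le_five :
    (∀ (m m' : ℕ) (N : IntegralRep m) (N' : IntegralRep m'), m' ≤ 5 → m ≤ 2 → N.domain = {x | ∀ i, x i ∈ Set.Ioo (0:ℝ) 1} → N.IsRational → N'.domain = {x | ∀ i, x i ∈ Set.Ioo (0:ℝ) 1} → N'.IsRational → N.value = N'.value → Equivalent N N') ↔
    (∀ (m m' : ℕ) (N : IntegralRep m) (N' : IntegralRep m'), m ≤ 5 → m' ≤ 5 →
      N.domain = {x | ∀ i, x i ∈ Set.Ioo (0:ℝ) 1} → N.IsRational →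
      N'.domain = {x | ∀ i, x i ∈ Set.Ioo (0:ℝ) 1} → N'.IsRational →
      N.value = N'.value → Equivalent N N') := by
  rw [stub_boxRigidity_var2223_iff_boxVanishingLe, boxRigidityLe_iff_boxVanishingLe, max_self]

/-- **The residual is exactly dimensions `2` to `5`**: BoxVanishing(dim ≤ 1) is a theorem of the tree
(`boxVanishingLe_one`: Baker's theorem on linear forms in logarithms through `boxRigidity_of_le_one`),
so V2223 ⟺ "every box-rational representation on `(0,1)^m`, `2 ≤ m ≤ 5`, of value `0` is a relation".
[cite: KontsevichZagier2001, §1.2 Conjecture 1] -/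
theorem stub_boxRigidity_var2223_iff_boxVanishing_two_le_five :
    (∀ (m m' : ℕ) (N : IntegralRep m) (N' : IntegralRep m'), m' ≤ 5 → m ≤ 2 → N.domain = {x | ∀ i, x i ∈ Set.Ioo (0:ℝ) 1} → N.IsRational → N'.domain = {x | ∀ i, x i ∈ Set.Ioo (0:ℝ) 1} → N'.IsRational → N.value = N'.value → Equivalent N N') ↔
    (∀ (m : ℕ) (N : IntegralRep m), 2 ≤ m → m ≤ 5 → N.domain = {x | ∀ i, x i ∈ Set.Ioo (0:ℝ) 1} →
      N.IsRational → N.value = 0 → of N ∈ relations) := by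
  rw [stub_boxRigidity_var2223_iff_boxVanishingLe]
  refine ⟨fun h m N _ hm => h m N hm, fun h m N hm => ?_⟩
  rcases Nat.lt_or_ge m 2 with hm2 | hm2
  · exact boxVanishingLe_one m N (by omega)
  · exact h m N hm2 hm

/-- **V2223 ⇒ BoxVanishing in dimension `2`** (the first open layer: for every `c : ℚ` it contains the
instance `G = c → [(0,1)², 1/(1+x²y²) − c] ∈ relations`, `G` Catalan's constant, and the joint
`π²`/`log 2` layer whose rigidity input `Indep_ℚ(1, π², log 2)` is open).
[cite: KontsevichZagier2001, §1.2 Conjecture 1] -/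
theorem boxVanishing_two_of_stub_boxRigidity_var2223
    (h : ∀ (m m' : ℕ) (N : IntegralRep m) (N' : IntegralRep m'), m' ≤ 5 → m ≤ 2 → N.domain = {x | ∀ i, x i ∈ Set.Ioo (0:ℝ) 1} → N.IsRational → N'.domain = {x | ∀ i, x i ∈ Set.Ioo (0:ℝ) 1} → N'.IsRational → N.value = N'.value → Equivalent N N')
    (N : IntegralRep 2) (hNd : N.domain = {x | ∀ i, x i ∈ Set.Ioo (0:ℝ) 1}) (hNr : N.IsRational)
    (hv : N.value = 0) : of N ∈ relations :=
  stub_boxRigidity_var2223_iff_boxVanishingLe.1 h 2 N (by norm_num) hNd hNr hv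

/-- **`KontsevichZagierPeriods ⇒ V2223`**: the variant is a special case of Conjecture 1 for the
tree's calculus (`leaves_of_statement`) — a refutation of the variant would refute the Summit.
[cite: KontsevichZagier2001, §1.2 Conjecture 1] -/
theorem stub_boxRigidity_var2223_of_statement (h : _root_.KontsevichZagierPeriods) :
    ∀ (m m' : ℕ) (N : IntegralRep m) (N' : IntegralRep m'), m' ≤ 5 → m ≤ 2 → N.domain = {x | ∀ i, x i ∈ Set.Ioo (0:ℝ) 1} → N.IsRational → N'.domain = {x | ∀ i, x i ∈ Set.Ioo (0:ℝ) 1} → N'.IsRational → N.value = N'.value → Equivalent N N' :=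
  fun m m' N N' _ _ => (leaves_of_statement h).1 m m' N N'

/-- **The parent leaf ⇒ V2223** (the variant is a specialisation of `stub_boxRigidity`; the converse
is not claimed — the parent is BoxVanishing in ALL dimensions, `boxRigidity_of_boxVanishing` / `boxVanishing_of_boxRigidity`).
[cite: KontsevichZagier2001, §1.2 Conjecture 1] -/
theorem stub_boxRigidity_var2223_of_parent
    (h : ∀ (m m' : ℕ) (N : IntegralRep m) (N' : IntegralRep m'), N.domain = {x | ∀ i, x i ∈ Set.Ioo (0:ℝ) 1} → N.IsRational → N'.domain = {x | ∀ i, x i ∈ Set.Ioo (0:ℝ) 1} → N'.IsRational → N.value = N'.value → Equivalent N N') :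
    ∀ (m m' : ℕ) (N : IntegralRep m) (N' : IntegralRep m'), m' ≤ 5 → m ≤ 2 → N.domain = {x | ∀ i, x i ∈ Set.Ioo (0:ℝ) 1} → N.IsRational → N'.domain = {x | ∀ i, x i ∈ Set.Ioo (0:ℝ) 1} → N'.IsRational → N.value = N'.value → Equivalent N N' :=
  fun m m' N N' _ _ => h m m' N N'

/-- **The proved rung next to V2223**: the same two-slot statement with both bounds lowered to `1`
holds outright (`boxRigidityLe_of_max_le_one`, Baker) — the small-case move reaches a theorem only at
`max ≤ 1`, never at `max = 5`. [cite: KontsevichZagier2001, §1.2 Conjecture 1] -/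
theorem stub_boxRigidity_var2223_rung_one :
    ∀ (m m' : ℕ) (N : IntegralRep m) (N' : IntegralRep m'), m' ≤ 1 → m ≤ 1 →
      N.domain = {x | ∀ i, x i ∈ Set.Ioo (0:ℝ) 1} → N.IsRational →
      N'.domain = {x | ∀ i, x i ∈ Set.Ioo (0:ℝ) 1} → N'.IsRational →
      N.value = N'.value → Equivalent N N' :=
  fun m m' N N' hm' hm => boxRigidityLe_of_max_le_one 1 1 (le_of_eq (max_self 1)) m m' N N' hm hm'

end Summit.KontsevichZagierPeriods.KontsevichZagierPeriods.Theorems
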